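import Literature.AlgebraicGeometry.Motives.SeesawChartRepr
import Literature.AlgebraicGeometry.Motives.SeesawChartSections
import Literature.AlgebraicGeometry.Modules.DualSectionsEquiv
import HarnessLib

/-!
# The dual kernel representation on a seesaw chart is a corollary of the `H⁰` one for the dual module:
# `DualKernelRepr X 𝓕 U h𝓕` from `H0KernelRepr X (𝓕^∨) U` (Mumford, *Abelian Varieties*, §5, §10)

`Motives/SeesawChartRepr` states two properties of a quasi-coherent module `𝓕` on `X ×_ℂ W` over an affine chart
`U ⊆ W` (`A = Γ(W, U)`): a two-term complex of finite projective `A`-modules computes, naturally in the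
`A`-algebra `B`,
* `SeesawSubscheme.H0KernelRepr X 𝓕 U` : the sections `H⁰(X_B, 𝓕_B)` (`H0`, base change `H0map`);
* `SeesawSubscheme.DualKernelRepr X 𝓕 U h𝓕` : the dual sections `Hom(𝓕_B|_⊤, 𝒪|_⊤)` (`DualSec`, base change
  `DualSecMap`), for `𝓕` of rank one.

**This file: the second follows from the first applied to the dual module `𝓕^∨ = Modules.dual 𝓕`** — with no
geometry: ★ `Modules/DualSectionsEquiv.dualSectionsEquiv f h𝓕 : Γ(f^*(𝓕^∨), ⊤) ≃ₗ ((f^*𝓕)|_⊤ ⟶ 𝒪|_⊤)`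
(Hartshorne II Ex. 5.1 (b), (d)) identifies `H0 X (Modules.dual 𝓕) U B` with `DualSec X 𝓕 U B` (`B`-linearly: both
`B`-structures are `Module.compHom toTopRing`), and ★ `dualSectionsEquiv_naturality` is literally the statement that
this identification carries `H0map X (Modules.dual 𝓕) U φ` to `DualSecMap X 𝓕 U h𝓕 φ` (its transport
`pullbackComp ≪≫ pullbackCongr` is `FBIso`, its right-hand side is `DualSecMap`).

* §1 `dualSecEquivH0 h𝓕 B : DualSec X 𝓕 U B ≃ₗ[B] H0 X (Modules.dual 𝓕) U B` and its naturality
  `dualSecEquivH0_dualSecMap` (through the UNAPPLIED `rfl` equations `fbIso_eq` / `dualSecMap_eq` / `h0map_eq`: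
  rewriting with them is fast, whereas `exact`/`convert` against the applied transport maps makes the elaborator
  unfold `pullback` isomorphisms of concrete schemes and time out);
* §2 **`dualKernelRepr_of_h0KernelRepr_dual (h𝓕 : HasRank 𝓕 1) :
  H0KernelRepr X (Modules.dual 𝓕) U → DualKernelRepr X 𝓕 U h𝓕`**.

Since `Modules.dual 𝓕` has rank one (★ `Modules/DetClassDual.hasRank_dual`) and is quasi-coherent
(★ `Modules/RankOneDescentAlongH0Iso.isQuasicoherent_of_hasRank`), every discharge of `H0KernelRepr` for rank-one
modules yields `DualKernelRepr` through this file (Mumford, §5, p. 46: "the same argument applied to the dual").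
Everything is proved; no named facts; one definition (`dualSecEquivH0`, the `B`-linear repackaging of an inverse
linear equivalence). Cell `hodgecm-mathlib`, M13 node N1 (1b) dual twin (B-p10 (g8)); generic over the chart, books 0.

## References

* D. Mumford, *Abelian Varieties*, TIFR Studies in Mathematics 5 (1970), §5 (pp. 46–47), §10 (p. 89). [MumfordAV1970]
* R. Hartshorne, *Algebraic Geometry*, GTM 52 (1977), II Ex. 5.1 (b), (d). [Hartshorne1977]
-/

noncomputable section

-- `TopCat.Presheaf`/`Scheme.Modules` are not reducible (as in ★ `Modules/DualSectionsEquiv`).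
set_option backward.isDefEq.respectTransparency false

open CategoryTheory CategoryTheory.Limits AlgebraicGeometry MonoidalCategory CartesianMonoidalCategory
open scoped TensorProduct

namespace Literature.AlgebraicGeometry.Motives

namespace SeesawSubscheme

open Literature.AlgebraicGeometry.Modules

variable (X : SchemeOver ℂ) {W : SchemeOver ℂ} (𝓕 : (X ⊗ W).left.Modules) (U : W.left.affineOpens)

/-! ## §1 `DualSec X 𝓕 U B ≃ₗ[B] H0 X (𝓕^∨) U B` (brick (C)) and its naturality in `B` -/

/-- **`Hom(𝓕_B|_⊤, 𝒪|_⊤) ≃ₗ[B] H⁰(X_B, (𝓕^∨)_B)`**: the inverse of ★ `dualSectionsEquiv` for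
`f = 1_X × u_B`, `B`-linear because both `B`-module structures are `Module.compHom` through `toTopRing`
(non-Prop plumbing). [cite: Hartshorne1977, II Ex. 5.1 (b) and (d)] -/
def dualSecEquivH0 (h𝓕 : HasRank 𝓕 1) (B : Type) [CommRing B] [Algebra Γ(W.left, U) B] :
    DualSec X 𝓕 U B ≃ₗ[B] H0 X (Modules.dual 𝓕) U B :=
  @AddEquiv.toLinearEquiv B (DualSec X 𝓕 U B) (H0 X (Modules.dual 𝓕) U B) _ _ _
    (instModuleDualSec X 𝓕 U B) (instModuleH0 X (Modules.dual 𝓕) U B)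
    ((dualSectionsEquiv (X ◁ specTestHom U B).left h𝓕).symm.toAddEquiv :
      DualSec X 𝓕 U B ≃+ H0 X (Modules.dual 𝓕) U B)
    fun b μ =>
      -- both `B`-actions are `Module.compHom toTopRing`: `b • x = toTopRing b • x` definitionally
      (dualSectionsEquiv (X ◁ specTestHom U B).left h𝓕).symm.map_smul (toTopRing X U B b) μ

/-- `dualSecEquivH0` is `(dualSectionsEquiv _ h𝓕)⁻¹` as a function. [folklore] [cite: MumfordAV1970, §5 (pp. 46–47)] -/
theorem dualSecEquivH0_apply (h𝓕 : HasRank 𝓕 1) (B : Type) [CommRing B] [Algebra Γ(W.left, U) B]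
    (μ : DualSec X 𝓕 U B) :
    dualSecEquivH0 X 𝓕 U h𝓕 B μ = (dualSectionsEquiv (X ◁ specTestHom U B).left h𝓕).symm μ := rfl

/-- `(1 × Spec φ) ≫ (1 × u_B) = 1 × u_C`. [folklore] [cite: MumfordAV1970, §5 (pp. 46–47)] -/
theorem whiskerLeft_specTestMap_left_comp {B C : Type} [CommRing B] [Algebra Γ(W.left, U) B] [CommRing C]
    [Algebra Γ(W.left, U) C] (φ : B →ₐ[Γ(W.left, U)] C) :
    (X ◁ specTestMap U φ).left ≫ (X ◁ specTestHom U B).left = (X ◁ specTestHom U C).left := by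
  rw [← Over.comp_left, ← MonoidalCategory.whiskerLeft_comp, specTestMap_comp]

/-- `FBIso` with the composite identity named (`rfl`, proof-irrelevant `pullbackCongr` argument). [folklore] [cite: MumfordAV1970, §5 (pp. 46–47)] -/
theorem fbIso_eq (𝓕' : (X ⊗ W).left.Modules) {B C : Type} [CommRing B] [Algebra Γ(W.left, U) B] [CommRing C]
    [Algebra Γ(W.left, U) C] (φ : B →ₐ[Γ(W.left, U)] C) :
    FBIso X 𝓕' U φ =
      (Scheme.Modules.pullbackComp (X ◁ specTestMap U φ).left (X ◁ specTestHom U B).left).app 𝓕' ≪≫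
        (Scheme.Modules.pullbackCongr (whiskerLeft_specTestMap_left_comp X U φ)).app 𝓕' :=
  rfl

/-- `DualSecMap` UNAPPLIED (`rfl` on the literal body; unapplied `rfl`s
check fast, applied ones do not). [folklore] [cite: MumfordAV1970, §5 (pp. 46–47)] -/
theorem dualSecMap_eq (h𝓕 : HasRank 𝓕 1) {B C : Type} [CommRing B] [Algebra Γ(W.left, U) B] [CommRing C]
    [Algebra Γ(W.left, U) C] (φ : B →ₐ[Γ(W.left, U)] C) :
    DualSecMap X 𝓕 U h𝓕 φ = fun μ =>
      ((sheafHomMapLeft (FBIso X 𝓕 U φ).inv (unitModule (X ⊗ specTest U C).left)).app ⊤)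
        (((pullbackDualIso (X ◁ specTestMap U φ).left
            (HasRank.isFiniteLocallyFree' (hasRank_FB X 𝓕 U h𝓕 B))).hom.app ⊤)
          (unitSection (X ◁ specTestMap U φ).left (Modules.dual (FB X 𝓕 U B)) ⊤ μ)) :=
  rfl

/-- `H0map` UNAPPLIED (`rfl` on the literal body). [folklore] [cite: MumfordAV1970, §5 (pp. 46–47)] -/
theorem h0map_eq (𝓕' : (X ⊗ W).left.Modules) {B C : Type} [CommRing B] [Algebra Γ(W.left, U) B] [CommRing C]
    [Algebra Γ(W.left, U) C] (φ : B →ₐ[Γ(W.left, U)] C) :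
    H0map X 𝓕' U φ = fun s =>
      ((FBIso X 𝓕' U φ).hom.app ⊤) (unitSection (X ◁ specTestMap U φ).left (FB X 𝓕' U B) ⊤ s) :=
  rfl

/-- The naturality square on a section `s` of `(𝓕^∨)_B`, read through `dualSectionsEquiv`
(= ★ `dualSectionsEquiv_naturality`, reversed). [cite: Hartshorne1977, II Ex. 5.1 (d)] -/
theorem dualSecMap_dualSectionsEquiv (h𝓕 : HasRank 𝓕 1) {B C : Type} [CommRing B] [Algebra Γ(W.left, U) B]
    [CommRing C] [Algebra Γ(W.left, U) C] (φ : B →ₐ[Γ(W.left, U)] C)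
    (s : H0 X (Modules.dual 𝓕) U B) :
    DualSecMap X 𝓕 U h𝓕 φ (dualSectionsEquiv (X ◁ specTestHom U B).left h𝓕 s) =
      dualSectionsEquiv (X ◁ specTestHom U C).left h𝓕 (H0map X (Modules.dual 𝓕) U φ s) := by
  have key := dualSectionsEquiv_naturality (X ◁ specTestMap U φ).left (X ◁ specTestHom U B).left h𝓕
    (whiskerLeft_specTestMap_left_comp X U φ) s
  rw [dualSecMap_eq, h0map_eq, fbIso_eq, fbIso_eq]
  beta_reduce
  exact key.symm

/-- **NATURALITY of `dualSecEquivH0`**: it carries `DualSecMap X 𝓕 U h𝓕 φ` to `H0map X (𝓕^∨) U φ` — this IS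
★ `dualSectionsEquiv_naturality` (its transport `pullbackComp ≪≫ pullbackCongr` is `FBIso X (𝓕^∨) U φ`,
its right-hand side is `DualSecMap`). [cite: Hartshorne1977, II Ex. 5.1 (d)] [cite: MumfordAV1970, §5 Cor. 2 (p. 50) and §10 (p. 89)] -/
theorem dualSecEquivH0_dualSecMap (h𝓕 : HasRank 𝓕 1) {B C : Type} [CommRing B] [Algebra Γ(W.left, U) B]
    [CommRing C] [Algebra Γ(W.left, U) C] (φ : B →ₐ[Γ(W.left, U)] C) (μ : DualSec X 𝓕 U B) :
    dualSecEquivH0 X 𝓕 U h𝓕 C (DualSecMap X 𝓕 U h𝓕 φ μ) =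
      H0map X (Modules.dual 𝓕) U φ (dualSecEquivH0 X 𝓕 U h𝓕 B μ) := by
  rw [dualSecEquivH0_apply, dualSecEquivH0_apply, LinearEquiv.symm_apply_eq]
  -- write `μ = dualSectionsEquiv _ s`
  obtain ⟨s, rfl⟩ := (dualSectionsEquiv (X ◁ specTestHom U B).left h𝓕).surjective μ
  rw [LinearEquiv.symm_apply_apply]
  exact dualSecMap_dualSectionsEquiv X 𝓕 U h𝓕 φ s

/-! ## §2 The dual socket from the `H⁰` socket of the dual module -/

/-- **`DualKernelRepr X 𝓕 U h𝓕` follows from `H0KernelRepr X (𝓕^∨) U`**: transport the kernel representation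
`θ_B : H⁰(X_B, (𝓕^∨)_B) ≃ₗ[B] ker(d ⊗ B)` along `dualSecEquivH0`; naturality is `dualSecEquivH0_dualSecMap` followed by
the naturality of `θ`. [cite: MumfordAV1970, §5 (pp. 46–47)] -/
theorem dualKernelRepr_of_h0KernelRepr_dual (h𝓕 : HasRank 𝓕 1) (h : H0KernelRepr X (Modules.dual 𝓕) U) :
    DualKernelRepr X 𝓕 U h𝓕 := by
  obtain ⟨K0, K1, i₁, i₂, i₃, i₄, i₅, i₆, i₇, i₈, d, θ, hθ⟩ := h
  refine ⟨K0, K1, i₁, i₂, i₃, i₄, i₅, i₆, i₇, i₈, d, fun B _ _ => (dualSecEquivH0 X 𝓕 U h𝓕 B).trans (θ B), ?_⟩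
  intro B C _ _ _ _ φ μ
  change ((θ C (dualSecEquivH0 X 𝓕 U h𝓕 C (DualSecMap X 𝓕 U h𝓕 φ μ)) : C ⊗[Γ(W.left, U)] K0)) =
    φ.toLinearMap.rTensor K0 ((θ B (dualSecEquivH0 X 𝓕 U h𝓕 B μ)) : B ⊗[Γ(W.left, U)] K0)
  rw [dualSecEquivH0_dualSecMap]
  exact hθ B C φ _

end SeesawSubscheme

end Literature.AlgebraicGeometry.Motives

end
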